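/-
# [B4] (2.3)–(2.4) p.575 — the Leibniz reduction of the HÖLDER probe past `h_j`, in the pairing that is uniform in `η`

statement-level skeleton of published theorems with citation tags; proofs where landed; nothing here is a claim about
the Yang–Mills mass gap

[B4] = Balaban, *Regularity and decay of lattice Green's functions*, Commun. Math. Phys. 89 (1983) 571–597.

p.575 (2.3)–(2.4) are the Leibniz and Hölder-quotient rules for products `h·f`; p.578 (2.18) «using (2.3), (2.4) and
Lemma 2.2 we get ‖h_{ω₀}G_k(□_{ω₀},Ã_{ω₀})h_{ω₀}K_{ω₁}…h_{ω_n}f‖_{1,α} ≤ c₁‖…‖_∞».  The owner's operator form of the Hölder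
probe (`B4Ineq19WalkRoute` §2, §4: `P_H = σ·(E_{xy′}[UW′] − E_{xx′}[U] − (E_{xy}[W] − E_{xx}[1]))`,
`holderOp_mul_mulH_expand`, `norm_holderOp_letter_le`) splits `P_H·h` into `h(x)P_H`, a transported bond difference
weighted by `σ(h(x′) − h(x))` and TWO EVALUATIONS weighted by the bond increments `σ(h(y′) − h(x′))`, `σ(h(y) − h(x))`.
With the print's scaling `σ = η^{-1}·|x − x′|^{-α}` each of the two evaluation terms alone is of size `η^{-α}`; (2.4)
pairs them.  THIS FILE gives the paired split and its norm bound: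

`P_H·h = h(x)·P_H + σ(h(x′) − h(x))·E_{xx′}[U]P_{b′} + σ(h(y′) − h(x′))·(E_{xy′}[UW′] − E_{xy}[W])
        + σ((h(y′) − h(x′)) − (h(y) − h(x)))·E_{xy}[W]`

(`holderOp_mul_mulH_pair`): the third term is a bond increment of `h` times a TRANSPORTED VALUE DIFFERENCE between
`y` and `y′` (small by the derivative bound along a chain), the fourth the MIXED SECOND DIFFERENCE of `h` (small by
`B4HCubeMixedDiff`) times an evaluation.  `norm_holderOp_letter_pair`: `‖P_H·(hGh)‖ ≤ γ_H′ + θ_aγ_T + θ_bγ_Δ + θ_mγ_V`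
from `γ_H′ ≥ ‖P_H·G‖`, `γ_T ≥ ‖E_{xx′}[U]P_{b′}·G‖`, `γ_Δ ≥ ‖(E_{xy′}[UW′] − E_{xy}[W])·G·h‖`, `γ_V ≥ ‖E_{xy}[W]·G‖` and
`θ_a ≥ |σ(h(x′)−h(x))|`, `θ_b ≥ |σ(h(y′)−h(x′))|`, `θ_m ≥ |σ((h(y′)−h(x′)) − (h(y)−h(x)))|` (`|h| ≤ 1`).

HONEST SCOPE.  Operator algebra and the triangle inequality only (any `σ`, `U`, `W`, `G`, `h`); the sizes are supplied
on the box carriers in the sequel.  No `def`, no `Prop` fact, no `sorry`; axioms standard.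
-/
import Literature.MathematicalPhysics.QuantumFieldTheory.Balaban1983to89.B4Ineq19WalkRoute

namespace Literature.MathematicalPhysics.QuantumFieldTheory.Balaban1983to89.B4HolderProbeLeibniz

open Literature.MathematicalPhysics.QuantumFieldTheory.Balaban1983to89.B4GaugeCovariance
open Literature.MathematicalPhysics.QuantumFieldTheory.Balaban1983to89.B4Commutators25to211 (mulH)
open Literature.MathematicalPhysics.QuantumFieldTheory.Balaban1983to89.B4Ineq110WalkRoute (norm_mulH_le)
open Literature.MathematicalPhysics.QuantumFieldTheory.Balaban1983to89.B4Ineq19WalkRoute (holderOp_mul_mulH)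
open scoped Matrix
open scoped Matrix.Norms.Operator

noncomputable section

/-! ## The paired split of `P_H·h` and the letter bound -/

variable {X κ : Type*} [Fintype X] [Fintype κ] [DecidableEq X] [DecidableEq κ]

/-- **THE PAIRED LEIBNIZ SPLIT OF THE HÖLDER PROBE PAST `h`** ((2.3)–(2.4) in operator form):
`P_H·h = h(x)·P_H + σ(h(x′)−h(x))·(E_{xy′}[UW′] − E_{xx′}[U]) + σ(h(y′)−h(x′))·(E_{xy′}[UW′] − E_{xy}[W])
+ σ((h(y′)−h(x′)) − (h(y)−h(x)))·E_{xy}[W]`. [cite: Balaban1983RegularityDecay, (2.3)–(2.4) p.575, (2.18) p.578] -/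
theorem holderOp_mul_mulH_pair (x y x' y' : X) (U : Matrix κ κ ℝ) (W : X → X → Matrix κ κ ℝ) (σ : ℝ)
    (h : X → ℝ) :
    σ • (unitOp x y' (U * W x' y') - unitOp x x' U - (unitOp x y (W x y) - unitOp x x 1)) * mulH (ι := κ) h
      = h x • (σ • (unitOp x y' (U * W x' y') - unitOp x x' U - (unitOp x y (W x y) - unitOp x x 1)))
        + (σ * (h x' - h x)) • (unitOp x y' (U * W x' y') - unitOp x x' U)
        + (σ * (h y' - h x')) • (unitOp x y' (U * W x' y') - unitOp x y (W x y))
        + (σ * (h y' - h x' - (h y - h x))) • unitOp x y (W x y) := by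
  rw [holderOp_mul_mulH]
  module

/-- **THE PER-CUBE HÖLDER INPUT FROM PAIRED INPUTS ON THE CUBE PROPAGATOR** («using (2.3), (2.4) and Lemma 2.2»): for
any operator `G` and any `h` with `|h| ≤ 1`, `‖P_H·(hGh)‖ ≤ γ_H′ + θ_aγ_T + θ_bγ_Δ + θ_mγ_V` from
`γ_H′ ≥ ‖P_H·G‖` (Hölder quotient of the covariant derivatives of `G`, (2.16)), `γ_T ≥ ‖(E_{xy′}[UW′] − E_{xx′}[U])·G‖`
(a transported bond difference), `γ_Δ ≥ ‖(E_{xy′}[UW′] − E_{xy}[W])·G·h‖` (a transported VALUE difference of `Ghφ`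
between `y` and `y′`), `γ_V ≥ ‖E_{xy}[W]·G‖` (an evaluation) and the weighted increments of `h`:
`θ_a ≥ |σ(h(x′)−h(x))|`, `θ_b ≥ |σ(h(y′)−h(x′))|`, `θ_m ≥ |σ((h(y′)−h(x′)) − (h(y)−h(x)))|` (the mixed second
difference). [cite: Balaban1983RegularityDecay, (2.3)–(2.4) p.575, (2.14) p.577, (2.16)–(2.18) pp.577–578] -/
theorem norm_holderOp_letter_pair (x y x' y' : X) (U : Matrix κ κ ℝ) (W : X → X → Matrix κ κ ℝ) (σ : ℝ)
    (h : X → ℝ) (hh : ∀ z, |h z| ≤ 1) (G : Matrix (X × κ) (X × κ) ℝ) {γH' γT γΔ γV θa θb θm : ℝ}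
    (hγT0 : 0 ≤ γT) (hγV0 : 0 ≤ γV)
    (hγH' : ‖σ • (unitOp x y' (U * W x' y') - unitOp x x' U - (unitOp x y (W x y) - unitOp x x 1)) * G‖ ≤ γH')
    (hγT : ‖(unitOp x y' (U * W x' y') - unitOp x x' U) * G‖ ≤ γT)
    (hγΔ : ‖(unitOp x y' (U * W x' y') - unitOp x y (W x y)) * G * mulH (ι := κ) h‖ ≤ γΔ)
    (hγV : ‖unitOp x y (W x y) * G‖ ≤ γV)
    (hθa : |σ * (h x' - h x)| ≤ θa) (hθb : |σ * (h y' - h x')| ≤ θb)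
    (hθm : |σ * (h y' - h x' - (h y - h x))| ≤ θm) :
    ‖σ • (unitOp x y' (U * W x' y') - unitOp x x' U - (unitOp x y (W x y) - unitOp x x 1))
        * (mulH (ι := κ) h * G * mulH (ι := κ) h)‖ ≤ γH' + θa * γT + θb * γΔ + θm * γV := by
  set PH : Matrix (X × κ) (X × κ) ℝ :=
    σ • (unitOp x y' (U * W x' y') - unitOp x x' U - (unitOp x y (W x y) - unitOp x x 1)) with hPH
  have hnH : ‖mulH (ι := κ) h‖ ≤ 1 := norm_mulH_le _ zero_le_one hh
  have hγH'0 : 0 ≤ γH' := (norm_nonneg _).trans hγH'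
  have hγΔ0 : 0 ≤ γΔ := (norm_nonneg _).trans hγΔ
  -- push the probe past the left factor `h`
  have hsplit : PH * (mulH (ι := κ) h * G * mulH (ι := κ) h)
      = h x • (PH * G * mulH (ι := κ) h)
        + (σ * (h x' - h x)) • ((unitOp x y' (U * W x' y') - unitOp x x' U) * G * mulH (ι := κ) h)
        + (σ * (h y' - h x')) • ((unitOp x y' (U * W x' y') - unitOp x y (W x y)) * G * mulH (ι := κ) h)
        + (σ * (h y' - h x' - (h y - h x))) • (unitOp x y (W x y) * G * mulH (ι := κ) h) := by
    rw [← Matrix.mul_assoc, ← Matrix.mul_assoc, hPH, holderOp_mul_mulH_pair]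
    simp only [Matrix.add_mul, Matrix.smul_mul]
  -- the size of each term: (scalar) · (input) · ‖h‖
  have hterm : ∀ (c : ℝ) (B : Matrix (X × κ) (X × κ) ℝ) {t b : ℝ}, |c| ≤ t → ‖B‖ ≤ b → 0 ≤ b →
      ‖c • (B * mulH (ι := κ) h)‖ ≤ t * b := by
    intro c B t b hc hB hb
    rw [norm_smul, Real.norm_eq_abs]
    exact mul_le_mul hc ((norm_mul_le _ _).trans (by
      calc ‖B‖ * ‖mulH (ι := κ) h‖ ≤ b * 1 := mul_le_mul hB hnH (norm_nonneg _) hb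
        _ = b := mul_one b)) (norm_nonneg _) ((abs_nonneg _).trans hc)
  have h1 : ‖h x • (PH * G * mulH (ι := κ) h)‖ ≤ 1 * γH' := hterm (h x) (PH * G) (hh x) hγH' hγH'0
  have h2 : ‖(σ * (h x' - h x)) • ((unitOp x y' (U * W x' y') - unitOp x x' U) * G * mulH (ι := κ) h)‖
      ≤ θa * γT := hterm _ _ hθa hγT hγT0
  have h3 : ‖(σ * (h y' - h x')) • ((unitOp x y' (U * W x' y') - unitOp x y (W x y)) * G * mulH (ι := κ) h)‖
      ≤ θb * γΔ := by
    rw [norm_smul, Real.norm_eq_abs]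
    exact mul_le_mul hθb hγΔ (norm_nonneg _) ((abs_nonneg _).trans hθb)
  have h4 : ‖(σ * (h y' - h x' - (h y - h x))) • (unitOp x y (W x y) * G * mulH (ι := κ) h)‖ ≤ θm * γV :=
    hterm _ _ hθm hγV hγV0
  rw [hsplit]
  calc _ ≤ ‖h x • (PH * G * mulH (ι := κ) h)
          + (σ * (h x' - h x)) • ((unitOp x y' (U * W x' y') - unitOp x x' U) * G * mulH (ι := κ) h)
          + (σ * (h y' - h x')) • ((unitOp x y' (U * W x' y') - unitOp x y (W x y)) * G * mulH (ι := κ) h)‖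
        + ‖(σ * (h y' - h x' - (h y - h x))) • (unitOp x y (W x y) * G * mulH (ι := κ) h)‖ := norm_add_le _ _
    _ ≤ (‖h x • (PH * G * mulH (ι := κ) h)‖
          + ‖(σ * (h x' - h x)) • ((unitOp x y' (U * W x' y') - unitOp x x' U) * G * mulH (ι := κ) h)‖
          + ‖(σ * (h y' - h x')) • ((unitOp x y' (U * W x' y') - unitOp x y (W x y)) * G * mulH (ι := κ) h)‖)
        + ‖(σ * (h y' - h x' - (h y - h x))) • (unitOp x y (W x y) * G * mulH (ι := κ) h)‖ := by
        gcongr; exact norm_add₃_le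
    _ ≤ (1 * γH' + θa * γT + θb * γΔ) + θm * γV := by linarith
    _ = γH' + θa * γT + θb * γΔ + θm * γV := by ring

end

end Literature.MathematicalPhysics.QuantumFieldTheory.Balaban1983to89.B4HolderProbeLeibniz
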